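import Summits.HodgeConjecture.CorCM.Model.Universe
import Summits.HodgeConjecture.CorCM.Model.TopTraceUnit
import Summits.HodgeConjecture.CorCM.Proofs.CupC
import Summits.HodgeConjecture.CorCM.Geometry.CupFacts
import Summits.HodgeConjecture.CorCM.StubTree.Qw8GeometricBlocks
import Summits.HodgeConjecture.CorCM.KunnethDegreeOne
import Summits.HodgeConjecture.HodgeConjecture.Theorems.EndoscopicMiddleDegreeCupProductAlgebraic
import Literature.AlgebraicTopology.SingularHomology.CohomologyOfPoint
import HarnessLib

/-!
# COR-CM fact rows Fg4 `cupAlg`, Fg5 `cupAssoc`, N3 `pull_H0`, N4 `hodge_F0` for the model of record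
# `Model.universeOf hHD hI hU h₃`

Cell `pub-hodgecm2`, seat model-2 (BINDER-OWNERS.md v1 rows Fg4, Fg5, N3, N4). KERNEL from tree theorems:
`Voisin2003_cupProduct_algebraicClasses_holds` (cup products of algebraic classes are algebraic, all
degrees; Voisin II Prop. 9.20) with the rational-lattice compatibility `ofRatClass_cupProduct`
(`CorCM/RationalExteriorSpan`); `Motives.bettiCup_assoc` (Hatcher §3.2); `H⁰` of the path-connected space
`X(ℂ)` is spanned by `1` (`pathConnectedSpace_complexPoints`, evaluation at a point
`singularCohomologyZeroEquiv`) and `f^* 1 = 1` (`bettiCohomology.map_one`); `F⁰ = Hᵏ`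
(`HodgeModel.ratF_of_nonpos`). The degree transport `castCoh` of the package (`subst; refl`) is computed by
`castCoh_bettiCup`.
-/

noncomputable section

open CategoryTheory
open Literature.AlgebraicGeometry.Motives (bettiCohomology bettiCup IsSmoothProjective)
open Literature.AlgebraicGeometry.Motives
open Literature.AlgebraicTopology.SingularHomology

namespace Summit.HodgeConjecture.CorCM

namespace Model

open Literature.NumberTheory.Automorphic
open Literature.NumberTheory.Automorphic.PicardCM
open Literature.AlgebraicGeometry.HodgeTheory


/-- The package's degree transport `castCoh` along `e : m = m'` turns `bettiCup h` (`h : p + q = m`) into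
`bettiCup (h.trans e)`. [folklore] -/
theorem castCoh_bettiCup (hHD : exists_isReal_hodgeModel) (hI : hodgePQ_independent_of_hodgeModel)
    (hU : BallQuotientUniformisedDatum) (h₃ : CMAbelianVarietyRealised)
    (X : Var) {p q m m' : ℕ} (h : p + q = m) (e : m = m')
    (x : (universeOf hHD hI hU h₃).Coh X p) (y : (universeOf hHD hI hU h₃).Coh X q) :
    (universeOf hHD hI hU h₃).castCoh X e (bettiCup h x y) = bettiCup (h.trans e) x y := by
  subst e
  rfl

/-- **Fg5 `Fact_cupAssoc`** for `universeOf`: associativity of the cup product up to the degree transport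
(`Motives.bettiCup_assoc`). [cite: HatcherAT2002, §3.2 p. 211] -/
theorem universeOf_fact_cupAssoc (hHD : exists_isReal_hodgeModel) (hI : hodgePQ_independent_of_hodgeModel)
    (hU : BallQuotientUniformisedDatum) (h₃ : CMAbelianVarietyRealised)
    : (universeOf hHD hI hU h₃).Fact_cupAssoc := by
  intro X i j k a b c
  change bettiCup rfl (bettiCup rfl a b) c = (universeOf hHD hI hU h₃).castCoh X _ (bettiCup rfl a (bettiCup rfl b c))
  rw [castCoh_bettiCup]
  exact bettiCup_assoc rfl rfl rfl _ a b c

/-- **Fg4 `Fact_cupAlg`** for `universeOf`: the cup product of rational algebraic classes of codimensions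
`p`, `q` is a rational algebraic class of codimension `p + q` (Voisin II Prop. 9.20 in the tree:
`Voisin2003_cupProduct_algebraicClasses_holds`; rational lattice: `ofRatClass_cupProduct`).
[cite: VoisinHodgeII2003, Prop. 9.20] -/
theorem universeOf_fact_cupAlg (hHD : exists_isReal_hodgeModel) (hI : hodgePQ_independent_of_hodgeModel)
    (hU : BallQuotientUniformisedDatum) (h₃ : CMAbelianVarietyRealised) : (universeOf hHD hI hU h₃).Fact_cupAlg := by
  intro X p q x y hx hy
  change (universeOf hHD hI hU h₃).castCoh X _ (bettiCup rfl x y) ∈ ratAlgebraicClasses (Var.scheme hU h₃ X) (p + q)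
  rw [castCoh_bettiCup]
  change ofRatClass (ComplexPoints (Var.scheme hU h₃ X)) (2 * (p + q)) (cupProduct _ x y) ∈
    algebraicClasses (Var.scheme hU h₃ X) (p + q)
  rw [ofRatClass_cupProduct]
  exact Summit.HodgeConjecture.HodgeConjecture.Theorems.Voisin2003_cupProduct_algebraicClasses_holds
    (Var.isSmoothProjective hU h₃ X) hx hy

/-- **N3 `Fact_pull_H0`** for `universeOf`: an endomorphism acts trivially on `H⁰(X(ℂ); ℚ) = ℚ · 1`
(`X(ℂ)` is path connected for the smooth projective interpretations; `f^* 1 = 1`).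
[cite: HatcherAT2002, §3.1 p. 199] -/
theorem universeOf_fact_pull_H0 (hHD : exists_isReal_hodgeModel) (hI : hodgePQ_independent_of_hodgeModel)
    (hU : BallQuotientUniformisedDatum) (h₃ : CMAbelianVarietyRealised) : (universeOf hHD hI hU h₃).Fact_pull_H0 := by
  intro X f
  haveI := pathConnectedSpace_complexPoints (Var.isSmoothProjective hU h₃ X)
  apply LinearMap.ext
  intro z
  change bettiCohomology.map f 0 z = z
  rw [eq_smul_one_of_pathConnectedSpace_rat z, map_smul]
  change _ • bettiCohomology.map f 0 (bettiOne (Var.scheme hU h₃ X)) = _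
  rw [bettiCohomology.map_one]

/-- **N4 `Fact_hodge_F0`** for `universeOf`: `F⁰ Hᵏ = Hᵏ` (`HodgeModel.ratF_of_nonpos`). [cite: VoisinHodgeI2002, §7.1.1] -/
theorem universeOf_fact_hodge_F0 (hHD : exists_isReal_hodgeModel) (hI : hodgePQ_independent_of_hodgeModel)
    (hU : BallQuotientUniformisedDatum) (h₃ : CMAbelianVarietyRealised)
    : (universeOf hHD hI hU h₃).Fact_hodge_F0 := by
  intro X k
  change (BettiUniverse.hodge hHD (Var.isSmoothProjective hU h₃ X) k).F 0 = ⊤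
  rw [BettiUniverse.hodge_F]
  exact HodgeModel.ratF_of_nonpos _ (Var.isSmoothProjective hU h₃ X) k le_rfl

end Model

end Summit.HodgeConjecture.CorCM

end
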